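import Summits.ABC.ABC.Theorems.DefiniteXiDefiniteRTControlPrimeTwoFacts
import HarnessLib

/-!
# stub-ideation k3 gen 17 — `stub_takahashi` (stmt-ABC-11338): elaboration sanity of the two XS
# owner-side helper statements H17.1 / H17.2 of `STUB-IDEAS-stub_takahashi-3.md` (gen 17).

H17.1 (the 1-stub line) needs part 7 of the k2-g12 landing chain
(`Summit.ABC.ABC.Theorems.DefiniteRTControlPrime.OfTakahashi.definiteRTControlPrime_of_takahashi`);
until it lands, the same shape is certified here against the LANDED two-fact closer (p838145).
-/

namespace Summit.ABC.ABC.Cruxes.DefiniteRTControlPrime.StubIdeas3G17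

open Literature.NumberTheory.EllipticCurves
open Literature.NumberTheory.EllipticCurves.ModularForms
open Summit.ABC.ABC.Theses.DefiniteXi

/-- H17.2 — the conditional item form of the crux (tenure rule: "known result now a Literature fact →
re-file the crux with `(h : Fact) →`"). -/
def DefiniteRTControlPrimeOfTakahashi : Prop :=
  Literature.NumberTheory.EllipticCurves.takahashi2001_thm_2_3_of_coprime →
    Summit.ABC.ABC.Theses.DefiniteXi.DefiniteRTControlPrime

/-- Today's discharge of H17.2 modulo Pasten's `163·δ` bound (landed p838145); on part 7 of the k2-g12
chain the hypothesis `h163` disappears (`… := OfTakahashi.definiteRTControlPrime_of_takahashi`). -/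
theorem definiteRTControlPrimeOfTakahashi_of_pasten163
    (h163 : PastenShimura2024_minimalDegree_le_163_mul) : DefiniteRTControlPrimeOfTakahashi :=
  fun hT => Summit.ABC.ABC.Theorems.DefiniteRTControlPrime.definiteRTControlPrime_of_two_facts hT h163

/-- H17.1 shape (the 1-stub line `Lines/Takahashi.lean`), written over the two-fact closer so that it
elaborates today: `stub_takahashi` VERBATIM + composition BY NAME. -/
theorem stub_takahashi : takahashi2001_thm_2_3_of_coprime := by
  sorry

/-- Composition BY NAME (today: second argument = the fact `h163` as a hypothesis; on part 7: none). -/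
theorem DefiniteRTControlPrime_of (h163 : PastenShimura2024_minimalDegree_le_163_mul) :
    Summit.ABC.ABC.Theses.DefiniteXi.DefiniteRTControlPrime :=
  definiteRTControlPrimeOfTakahashi_of_pasten163 h163 stub_takahashi

end Summit.ABC.ABC.Cruxes.DefiniteRTControlPrime.StubIdeas3G17
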